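import Summits.QuantumFields.BalabanUV.Beta.GAN24.ExchangeLatticeWordSlot
import Summits.QuantumFields.BalabanUV.Beta.GAN24.ExchangeSlotResum

/-!
# `BalabanUV.Beta.GAN24.ExchangeLatticeWordReduced` — binder row G-an2-4 ∕ (CONV-C), W-slot (α-0), ROW (C) AT LEVELS `j ≥ 1`, the (γ) hand's memo
# `HOME/b2b-balaban-gan24-formalise-leaf-06/g52/C-LEVELS-GE1.md` §17 ∕ §19 and `g54/C-LEVELS-GE1-g54.md` §27: **THE LITERAL TWO-FACE EE LATTICE WORD
# `Σ'_{u′} Σ'_{(y,w)} χ_α(y)χ_β(w)·((V_{μ,u} ∘ X̃♮_j) ∘ V_{ν,u′}) y w (inl α)(inl β)` OF A GENERIC LOCAL STENCIL FAMILY `S` IS THE REDUCED WORD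
# `Σ'_{y₁} Σ_a (Σ'_y χ_α(y)·V_{μ,u} y y₁ (inl α)(inl a))·(Σ'_z Σ_b X̃♮_j y₁ z (inl a)(inl b)·Σ'_{u′} Σ'_w χ_β(w)·V_{ν,u′} z w (inl b)(inl β))`, AND THE SWAP WORD's
# LATTICE-SUMMED BOND MAY BE MOVED TO THE RIGHT** (`V_{κ,v} = vertexOfK X̃♮_j Lc (unitS s_f s_m S) κ v`; every `j`, in-block root, all units, ALL axis patterns `(μ, ν, α, β)`;
# `S` local, fine-translation covariant, without field–multiplier blocks) — the generic-table twin of leaf-04's `EEWordValue` §2 ∕ `EEWordSwap` §1–§2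
# (G-an2-4 CRUX TEAM (2), seat `b2b-balaban-gan24-formalise-leaf-06` = the (γ) hand, gen 54; journal INTENT I-leaf06-g54-2)

NOT IN PRINT; OUR BOOKKEEPING ([folklore] `tsum` ∕ Fubini bookkeeping BY NAME; 0 `def`, 0 cited fact, 0 `def … : Prop`, 0 sorry).
HONEST FRAMING (cell contract, verbatim): «discharging `BetaPertH` makes Bałaban's UV stability UNCONDITIONAL — a real constructive-QFT result; it is NOT the continuum
limit and NOT the Clay problem.»  HONEST DEPENDENCY (verbatim): «continuum YM on T⁴ ⇐ BetaPertH ∧ nine spine estimates (0/9 proved); BetaPertH ⇐ (D1) ∧ (D4) ∧ CAP+tail;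
G-an2-4 gates asym, D1 and NE2/3/4.»

WHY.  leaf-04 g69's `DressedSourceZeroModeSucc.zmode_dressedSource_succ_inl_inl` (33_j, staged) reduces the ff zero mode of the dressed level-`(j+1)` source, at every level and on
every axis pattern, to `c·κ·(EE_direct + EE_swap)` — the two LITERAL two-face lattice words of the E-sector table, in the `comp (comp V X̃) V` currency with the pair sum
`Σ'_{(y,w)}`.  This lineage's exchange chain (`ExchangeWordCellPairing.exchangeWord_eq_cellPairing` → `ExchangeESectorValue.exchangeWord_sector_value` →
`ExchangeESectorPattern`) starts from the REDUCED word (leaf-04's `EEWordReduced.ee_word_reduced` left side at level `j`).  The passage literal → reduced was typed by leaf-04 for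
the WILSON table only (`EEWordValue.ee_word_outer_fubini` ∕ `EEWordSwap.ee_word_outer_fubini'` over `ExchangeSlotLiteral` ∕ `ExchangeFieldLegs`); this file and
`ExchangeLatticeWordReduced` are its generic-table twin, so that the level-`(j+1)` E-sector words meet the chain (`ExchangeESectorLatticeWords`) and road-P2's pair-form socket
(`CombChargeAntisymPairForm.exists_pairForm_of_word`).
* §4 **`twoFace_word_cov`**, **`tsum_swap_word`** — the two-face word is jointly coarse-bond covariant, so in the swap word the lattice-summed bond may be taken on the right
  (`ExchangeSlotResum.twoFace_word_cov_of ∕ tsum_eq_tsum_of_cov`; twins of `EEWordSwap` §1).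
* §5 **`literal_eq_reduced`** — the outer Fubini for ALL `(ν, β)` (`ExchangeLatticeWordSlot` §3 ⨾ §2 ⨾ `EEWordValue.fubini3`; the resummed right slot is bounded because it is
  `Lc`-periodic, `ExitFaceRightFamily.exists_abs_rightFamily_le`); **`sum_box_literal_eq_reduced`** (first bond over one cell — leaf-04's `EE_direct` shape) and
  **`sum_box_swap_literal_eq_reduced`** (cell index on the RIGHT bond — leaf-04's `EE_swap` shape — equals the reduced word with the bonds exchanged).
Asserts NO value of Bałaban's tables; discharges NOTHING of (C) ∕ (C)sym ∕ (Q-L) ∕ «T2Shape» ∕ «T2Drift» ∕ (hW, hWall); NEVER «G-an2-4 closed» as (CONV-C); NOT D1, NOT `BetaPertH`,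
NOT continuum, NOT Clay.  2026-08-24; no existing file touched.
-/

noncomputable section

open Finset
open scoped BigOperators
open Literature.MathematicalPhysics.QuantumFieldTheory
open Literature.MathematicalPhysics.QuantumFieldTheory.Balaban1983to89
open Literature.MathematicalPhysics.QuantumFieldTheory.Balaban1983to89.Beta
open B12Sec2to5 (l1 l1_nonneg)
open ExpKernelCalculus (Site MKer comp shiftK Decays BiLoc VertexFamily Zl summable_exp_shift summable_exp_shift' tsum_exp_shift')
open OneStepResolventKernel (Fib wsum LocStencil decays_mono biLoc_mono)
open OneStepKernelFamily (KInvStep vertexOfK vertexOfK_translate vertexFamily_vertexOfK decays_KInvStep)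
open AffineAveraging (box toSite)
open Summit.QuantumFields.BalabanUV.Beta.AxialDressingRooted (coDressKBmAt decays_coDressKBmAt)
open Summit.QuantumFields.BalabanUV.Beta.HessKerDressedUnits (unitK unitS unitS_apply decays_unitK locStencil_unitS)
open Summit.QuantumFields.BalabanUV.Beta.GAN24.EEWordReduced (shiftK_dressedStep)
open Summit.QuantumFields.BalabanUV.Beta.GAN24.ExchangeSlotResum (tsum_eq_tsum_of_cov twoFace_word_cov_of face_weight_periodic)
open Summit.QuantumFields.BalabanUV.Beta.GAN24.EEWordValue (fubini3)
open Summit.QuantumFields.BalabanUV.Beta.GAN24.ExitFaceLeftFamily (unitS_translate_of_translate)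
open Summit.QuantumFields.BalabanUV.Beta.GAN24.ExitFaceRightFamily (exists_abs_rightFamily_le)
open Summit.QuantumFields.BalabanUV.Beta.GAN24.ExchangeLatticeWordSlot (exists_decay_data_of tsum_prod_rightHalfVertex hasSum_literal_slot_of)

namespace Summit.QuantumFields.BalabanUV.Beta.GAN24.ExchangeLatticeWordReduced

variable {d : ℕ}

/-! ## §4 Joint coarse-bond covariance of the two-face word; the swap identity -/

section Cov

variable {Lc : ℕ} [NeZero Lc] {r : Fin (d + 1) → ℕ} {S : Fin (d + 1) → (Fin (d + 1) → ℤ) → MKer (d + 1) (Fib d)} {μ ν α β : Fin (d + 1)}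

/-- [folklore] **THE TWO-FACE WORD IS JOINTLY COARSE-BOND COVARIANT** (every level `j`, all units, any `(μ, ν, α, β)`, fine-translation covariant `S`):
`FF[(V_{ν,a+t} ∘ X̃♮_j) ∘ V_{μ,b+t}] = FF[(V_{ν,a} ∘ X̃♮_j) ∘ V_{μ,b}]` for every `t ∈ ℤ^{d+1}` (twin of `EEWordSwap.twoFace_word_cov`). -/
theorem twoFace_word_cov (hLc : 1 ≤ Lc) (hSt : ∀ (κ : Fin (d + 1)) (u v : Fin (d + 1) → ℤ), S κ (u + v) = shiftK (-v) (S κ u)) (sf sm : ℝ) (j : ℕ)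
    (a b t : Site (d + 1)) :
    ∑' yw : Site (d + 1) × Site (d + 1), (if yw.1 α % (Lc : ℤ) = (Lc : ℤ) - 1 then (1 : ℝ) else 0) * (if yw.2 β % (Lc : ℤ) = (Lc : ℤ) - 1 then (1 : ℝ) else 0) *
        comp (comp (vertexOfK (unitK sf sm (coDressKBmAt (toSite r) Lc (KInvStep (d := d) Lc j))) Lc (unitS sf sm S) ν (a + t))
          (unitK sf sm (coDressKBmAt (toSite r) Lc (KInvStep (d := d) Lc j))))
          (vertexOfK (unitK sf sm (coDressKBmAt (toSite r) Lc (KInvStep (d := d) Lc j))) Lc (unitS sf sm S) μ (b + t)) yw.1 yw.2 (Sum.inl α) (Sum.inl β) =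
      ∑' yw : Site (d + 1) × Site (d + 1), (if yw.1 α % (Lc : ℤ) = (Lc : ℤ) - 1 then (1 : ℝ) else 0) * (if yw.2 β % (Lc : ℤ) = (Lc : ℤ) - 1 then (1 : ℝ) else 0) *
        comp (comp (vertexOfK (unitK sf sm (coDressKBmAt (toSite r) Lc (KInvStep (d := d) Lc j))) Lc (unitS sf sm S) ν a)
          (unitK sf sm (coDressKBmAt (toSite r) Lc (KInvStep (d := d) Lc j))))
          (vertexOfK (unitK sf sm (coDressKBmAt (toSite r) Lc (KInvStep (d := d) Lc j))) Lc (unitS sf sm S) μ b) yw.1 yw.2 (Sum.inl α) (Sum.inl β) := by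
  have hXs : ∀ t' : Site (d + 1), shiftK (-((Lc : ℤ) • t')) (unitK sf sm (coDressKBmAt (toSite r) Lc (KInvStep (d := d) Lc j))) =
      unitK sf sm (coDressKBmAt (toSite r) Lc (KInvStep (d := d) Lc j)) := fun t' => shiftK_dressedStep (r := r) hLc sf sm j t'
  have hSu := unitS_translate_of_translate hSt sf sm
  exact twoFace_word_cov_of (N := Lc) (fun a' t' => vertexOfK_translate (N := Lc) hXs hSu ν a' t')
    (fun b' t' => vertexOfK_translate (N := Lc) hXs hSu μ b' t') hXs
    (ρ₁ := fun y : Site (d + 1) => (if y α % (Lc : ℤ) = (Lc : ℤ) - 1 then (1 : ℝ) else 0))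
    (ρ₂ := fun w : Site (d + 1) => (if w β % (Lc : ℤ) = (Lc : ℤ) - 1 then (1 : ℝ) else 0))
    (fun y s => face_weight_periodic Lc α y s) (fun w s => face_weight_periodic Lc β w s) a b t (Sum.inl α) (Sum.inl β)

/-- [folklore] **THE SWAP IDENTITY** (every level `j`, all units, any axes, any `c`, fine-translation covariant `S`):
`Σ'_{u′} FF[(V_{ν,u′} ∘ X̃♮_j) ∘ V_{μ,c}] = Σ'_{u′} FF[(V_{ν,c} ∘ X̃♮_j) ∘ V_{μ,u′}]` — in the swap word the lattice-summed bond may be taken to be the RIGHT one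
(twin of `EEWordSwap.tsum_swap_word`). -/
theorem tsum_swap_word (hLc : 1 ≤ Lc) (hSt : ∀ (κ : Fin (d + 1)) (u v : Fin (d + 1) → ℤ), S κ (u + v) = shiftK (-v) (S κ u)) (sf sm : ℝ) (j : ℕ) (c : Site (d + 1)) :
    ∑' u' : Site (d + 1), ∑' yw : Site (d + 1) × Site (d + 1), (if yw.1 α % (Lc : ℤ) = (Lc : ℤ) - 1 then (1 : ℝ) else 0) * (if yw.2 β % (Lc : ℤ) = (Lc : ℤ) - 1 then (1 : ℝ) else 0) *
        comp (comp (vertexOfK (unitK sf sm (coDressKBmAt (toSite r) Lc (KInvStep (d := d) Lc j))) Lc (unitS sf sm S) ν u')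
          (unitK sf sm (coDressKBmAt (toSite r) Lc (KInvStep (d := d) Lc j))))
          (vertexOfK (unitK sf sm (coDressKBmAt (toSite r) Lc (KInvStep (d := d) Lc j))) Lc (unitS sf sm S) μ c) yw.1 yw.2 (Sum.inl α) (Sum.inl β) =
      ∑' u' : Site (d + 1), ∑' yw : Site (d + 1) × Site (d + 1), (if yw.1 α % (Lc : ℤ) = (Lc : ℤ) - 1 then (1 : ℝ) else 0) * (if yw.2 β % (Lc : ℤ) = (Lc : ℤ) - 1 then (1 : ℝ) else 0) *
        comp (comp (vertexOfK (unitK sf sm (coDressKBmAt (toSite r) Lc (KInvStep (d := d) Lc j))) Lc (unitS sf sm S) ν c)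
          (unitK sf sm (coDressKBmAt (toSite r) Lc (KInvStep (d := d) Lc j))))
          (vertexOfK (unitK sf sm (coDressKBmAt (toSite r) Lc (KInvStep (d := d) Lc j))) Lc (unitS sf sm S) μ u') yw.1 yw.2 (Sum.inl α) (Sum.inl β) :=
  tsum_eq_tsum_of_cov (G := fun a b => ∑' yw : Site (d + 1) × Site (d + 1), (if yw.1 α % (Lc : ℤ) = (Lc : ℤ) - 1 then (1 : ℝ) else 0) * (if yw.2 β % (Lc : ℤ) = (Lc : ℤ) - 1 then (1 : ℝ) else 0) *
        comp (comp (vertexOfK (unitK sf sm (coDressKBmAt (toSite r) Lc (KInvStep (d := d) Lc j))) Lc (unitS sf sm S) ν a)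
          (unitK sf sm (coDressKBmAt (toSite r) Lc (KInvStep (d := d) Lc j))))
          (vertexOfK (unitK sf sm (coDressKBmAt (toSite r) Lc (KInvStep (d := d) Lc j))) Lc (unitS sf sm S) μ b) yw.1 yw.2 (Sum.inl α) (Sum.inl β))
    (fun a b t => twoFace_word_cov (μ := μ) (ν := ν) (α := α) (β := β) hLc hSt sf sm j a b t) c

end Cov

/-! ## §5 The outer Fubini for every axis pattern -/

section Fubini

variable {Lc : ℕ} [NeZero Lc] {r : Fin (d + 1) → ℕ} {S : Fin (d + 1) → (Fin (d + 1) → ℤ) → MKer (d + 1) (Fib d)} {μ ν α β : Fin (d + 1)}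

set_option maxHeartbeats 400000 in
/-- [folklore] **THE LITERAL TWO-FACE EE LATTICE WORD IS THE REDUCED WORD** (in-block root, `1 ≤ Lc`, level `j`, all units, ALL `(μ, ν, α, β)`, fixed first bond `(μ, u)`; `S` local,
fine-translation covariant, without field–multiplier blocks):
`Σ'_{u′} Σ'_{(y,w)} χ_α(y)χ_β(w)·((V_{μ,u} ∘ X̃♮_j) ∘ V_{ν,u′}) y w (inl α)(inl β)
  = Σ'_{y₁} Σ_a (Σ'_y χ_α(y)·V_{μ,u} y y₁ (inl α)(inl a))·(Σ'_z Σ_b X̃♮_j y₁ z (inl a)(inl b)·Σ'_{u′} Σ'_w χ_β(w)·V_{ν,u′} z w (inl b)(inl β))`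
(§3 ⨾ §2 ⨾ `EEWordValue.fubini3`, the resummed right slot bounded by `ExitFaceRightFamily.exists_abs_rightFamily_le`). -/
theorem literal_eq_reduced (hLc : 1 ≤ Lc) (hr : r ∈ box (d + 1) Lc) {Cs δs : ℝ} (hS : LocStencil S Cs δs) (hδs : 0 < δs)
    (hSt : ∀ (κ : Fin (d + 1)) (u v : Fin (d + 1) → ℤ), S κ (u + v) = shiftK (-v) (S κ u))
    (hS01 : ∀ (κ : Fin (d + 1)) (v y z : Site (d + 1)) (a m : Fin (d + 1)), S κ v y z (Sum.inl a) (Sum.inr m) = 0)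
    (hS10 : ∀ (κ : Fin (d + 1)) (v y z : Site (d + 1)) (m b : Fin (d + 1)), S κ v y z (Sum.inr m) (Sum.inl b) = 0)
    (sf sm : ℝ) (j : ℕ) (u : Site (d + 1)) :
    ∑' u' : Site (d + 1), ∑' yw : Site (d + 1) × Site (d + 1), (if yw.1 α % (Lc : ℤ) = (Lc : ℤ) - 1 then (1 : ℝ) else 0) * (if yw.2 β % (Lc : ℤ) = (Lc : ℤ) - 1 then (1 : ℝ) else 0) *
        comp (comp (vertexOfK (unitK sf sm (coDressKBmAt (toSite r) Lc (KInvStep (d := d) Lc j))) Lc (unitS sf sm S) μ u)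
          (unitK sf sm (coDressKBmAt (toSite r) Lc (KInvStep (d := d) Lc j))))
          (vertexOfK (unitK sf sm (coDressKBmAt (toSite r) Lc (KInvStep (d := d) Lc j))) Lc (unitS sf sm S) ν u') yw.1 yw.2 (Sum.inl α) (Sum.inl β) =
      ∑' y₁ : Site (d + 1), ∑ a : Fin (d + 1),
        (∑' y : Site (d + 1), (if y α % (Lc : ℤ) = (Lc : ℤ) - 1 then (1 : ℝ) else 0) *
          vertexOfK (unitK sf sm (coDressKBmAt (toSite r) Lc (KInvStep (d := d) Lc j))) Lc (unitS sf sm S) μ u y y₁ (Sum.inl α) (Sum.inl a)) *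
        (∑' z : Site (d + 1), ∑ b : Fin (d + 1), unitK sf sm (coDressKBmAt (toSite r) Lc (KInvStep (d := d) Lc j)) y₁ z (Sum.inl a) (Sum.inl b) *
          (∑' u' : Site (d + 1), ∑' w : Site (d + 1), (if w β % (Lc : ℤ) = (Lc : ℤ) - 1 then (1 : ℝ) else 0) *
            vertexOfK (unitK sf sm (coDressKBmAt (toSite r) Lc (KInvStep (d := d) Lc j))) Lc (unitS sf sm S) ν u' z w (Sum.inl b) (Sum.inl β))) := by
  classical
  rw [(hasSum_literal_slot_of (μ := μ) (ν := ν) (α := α) (β := β) hLc hr hS hδs hS01 hS10 sf sm j u).tsum_eq]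
  simp only [tsum_prod_rightHalfVertex (ν := ν) (β := β) hLc hr hS hδs sf sm j]
  obtain ⟨δ, Cv, C2, CX, hδ, hCv, -, hCX, hVF, -, hXu⟩ := exists_decay_data_of hLc hr hS hδs sf sm j μ u
  -- the resummed right slot is bounded (it is `Lc`-periodic)
  obtain ⟨M, hM⟩ := exists_abs_rightFamily_le (r := r) (S := S) (ν := ν) (β := β) hLc hSt sf sm j
  have hM0 : 0 ≤ M := (abs_nonneg _).trans (hM 0 0)
  exact fubini3 (f := fun y => (if y α % (Lc : ℤ) = (Lc : ℤ) - 1 then (1 : ℝ) else 0))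
    (V := fun y y₁ a => vertexOfK (unitK sf sm (coDressKBmAt (toSite r) Lc (KInvStep (d := d) Lc j))) Lc (unitS sf sm S) μ u y y₁ (Sum.inl α) (Sum.inl a))
    (X := fun y₁ z a b => unitK sf sm (coDressKBmAt (toSite r) Lc (KInvStep (d := d) Lc j)) y₁ z (Sum.inl a) (Sum.inl b))
    (T := fun b z => ∑' u' : Site (d + 1), ∑' w : Site (d + 1), (if w β % (Lc : ℤ) = (Lc : ℤ) - 1 then (1 : ℝ) else 0) *
      vertexOfK (unitK sf sm (coDressKBmAt (toSite r) Lc (KInvStep (d := d) Lc j))) Lc (unitS sf sm S) ν u' z w (Sum.inl b) (Sum.inl β))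
    (c := (Lc : ℤ) • u) hδ hCv hCX hM0
    (fun y => by split_ifs <;> simp) (fun y y₁ a => hVF μ u y y₁ (Sum.inl α) (Sum.inl a)) (fun y₁ z a b => hXu y₁ z (Sum.inl a) (Sum.inl b)) hM

/-- [folklore] **THE SAME WITH THE FIRST BOND OVER ONE CELL** (the shape of leaf-04's `DressedSourceZeroModeSucc` ∕ this lineage's `ExchangeWordCellPairing`):
`Σ_{u∈box} Σ'_{u′} FF[(V_{μ,toSite u} ∘ X̃♮_j) ∘ V_{ν,u′}] = Σ_{u∈box} (reduced word at u)`. -/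
theorem sum_box_literal_eq_reduced (hLc : 1 ≤ Lc) (hr : r ∈ box (d + 1) Lc) {Cs δs : ℝ} (hS : LocStencil S Cs δs) (hδs : 0 < δs)
    (hSt : ∀ (κ : Fin (d + 1)) (u v : Fin (d + 1) → ℤ), S κ (u + v) = shiftK (-v) (S κ u))
    (hS01 : ∀ (κ : Fin (d + 1)) (v y z : Site (d + 1)) (a m : Fin (d + 1)), S κ v y z (Sum.inl a) (Sum.inr m) = 0)
    (hS10 : ∀ (κ : Fin (d + 1)) (v y z : Site (d + 1)) (m b : Fin (d + 1)), S κ v y z (Sum.inr m) (Sum.inl b) = 0)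
    (sf sm : ℝ) (j : ℕ) :
    ∑ u ∈ box (d + 1) Lc, ∑' u' : Site (d + 1), ∑' yw : Site (d + 1) × Site (d + 1), (if yw.1 α % (Lc : ℤ) = (Lc : ℤ) - 1 then (1 : ℝ) else 0) * (if yw.2 β % (Lc : ℤ) = (Lc : ℤ) - 1 then (1 : ℝ) else 0) *
        comp (comp (vertexOfK (unitK sf sm (coDressKBmAt (toSite r) Lc (KInvStep (d := d) Lc j))) Lc (unitS sf sm S) μ (toSite u))
          (unitK sf sm (coDressKBmAt (toSite r) Lc (KInvStep (d := d) Lc j))))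
          (vertexOfK (unitK sf sm (coDressKBmAt (toSite r) Lc (KInvStep (d := d) Lc j))) Lc (unitS sf sm S) ν u') yw.1 yw.2 (Sum.inl α) (Sum.inl β) =
      ∑ u ∈ box (d + 1) Lc, ∑' y₁ : Site (d + 1), ∑ a : Fin (d + 1),
        (∑' y : Site (d + 1), (if y α % (Lc : ℤ) = (Lc : ℤ) - 1 then (1 : ℝ) else 0) *
          vertexOfK (unitK sf sm (coDressKBmAt (toSite r) Lc (KInvStep (d := d) Lc j))) Lc (unitS sf sm S) μ (toSite u) y y₁ (Sum.inl α) (Sum.inl a)) *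
        (∑' z : Site (d + 1), ∑ b : Fin (d + 1), unitK sf sm (coDressKBmAt (toSite r) Lc (KInvStep (d := d) Lc j)) y₁ z (Sum.inl a) (Sum.inl b) *
          (∑' u' : Site (d + 1), ∑' w : Site (d + 1), (if w β % (Lc : ℤ) = (Lc : ℤ) - 1 then (1 : ℝ) else 0) *
            vertexOfK (unitK sf sm (coDressKBmAt (toSite r) Lc (KInvStep (d := d) Lc j))) Lc (unitS sf sm S) ν u' z w (Sum.inl b) (Sum.inl β))) :=
  Finset.sum_congr rfl fun u _ => literal_eq_reduced (μ := μ) (ν := ν) (α := α) (β := β) hLc hr hS hδs hSt hS01 hS10 sf sm j (toSite u)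

/-- [folklore] **THE SWAP WORD, REDUCED**: with the cell index on the RIGHT bond (leaf-04's `EE_swap` shape), `Σ_{c∈box} Σ'_{u′} FF[(V_{ν,u′} ∘ X̃♮_j) ∘ V_{μ,toSite c}]`
equals the reduced word with the bonds exchanged, `(μ, ν) ↦ (ν, μ)` (§4 swap identity per cell, then §5). -/
theorem sum_box_swap_literal_eq_reduced (hLc : 1 ≤ Lc) (hr : r ∈ box (d + 1) Lc) {Cs δs : ℝ} (hS : LocStencil S Cs δs) (hδs : 0 < δs)
    (hSt : ∀ (κ : Fin (d + 1)) (u v : Fin (d + 1) → ℤ), S κ (u + v) = shiftK (-v) (S κ u))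
    (hS01 : ∀ (κ : Fin (d + 1)) (v y z : Site (d + 1)) (a m : Fin (d + 1)), S κ v y z (Sum.inl a) (Sum.inr m) = 0)
    (hS10 : ∀ (κ : Fin (d + 1)) (v y z : Site (d + 1)) (m b : Fin (d + 1)), S κ v y z (Sum.inr m) (Sum.inl b) = 0)
    (sf sm : ℝ) (j : ℕ) :
    ∑ c ∈ box (d + 1) Lc, ∑' u' : Site (d + 1), ∑' yw : Site (d + 1) × Site (d + 1), (if yw.1 α % (Lc : ℤ) = (Lc : ℤ) - 1 then (1 : ℝ) else 0) * (if yw.2 β % (Lc : ℤ) = (Lc : ℤ) - 1 then (1 : ℝ) else 0) *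
        comp (comp (vertexOfK (unitK sf sm (coDressKBmAt (toSite r) Lc (KInvStep (d := d) Lc j))) Lc (unitS sf sm S) ν u')
          (unitK sf sm (coDressKBmAt (toSite r) Lc (KInvStep (d := d) Lc j))))
          (vertexOfK (unitK sf sm (coDressKBmAt (toSite r) Lc (KInvStep (d := d) Lc j))) Lc (unitS sf sm S) μ (toSite c)) yw.1 yw.2 (Sum.inl α) (Sum.inl β) =
      ∑ u ∈ box (d + 1) Lc, ∑' y₁ : Site (d + 1), ∑ a : Fin (d + 1),
        (∑' y : Site (d + 1), (if y α % (Lc : ℤ) = (Lc : ℤ) - 1 then (1 : ℝ) else 0) *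
          vertexOfK (unitK sf sm (coDressKBmAt (toSite r) Lc (KInvStep (d := d) Lc j))) Lc (unitS sf sm S) ν (toSite u) y y₁ (Sum.inl α) (Sum.inl a)) *
        (∑' z : Site (d + 1), ∑ b : Fin (d + 1), unitK sf sm (coDressKBmAt (toSite r) Lc (KInvStep (d := d) Lc j)) y₁ z (Sum.inl a) (Sum.inl b) *
          (∑' u' : Site (d + 1), ∑' w : Site (d + 1), (if w β % (Lc : ℤ) = (Lc : ℤ) - 1 then (1 : ℝ) else 0) *
            vertexOfK (unitK sf sm (coDressKBmAt (toSite r) Lc (KInvStep (d := d) Lc j))) Lc (unitS sf sm S) μ u' z w (Sum.inl b) (Sum.inl β))) := by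
  refine Finset.sum_congr rfl fun c _ => ?_
  rw [tsum_swap_word (μ := μ) (ν := ν) (α := α) (β := β) hLc hSt sf sm j (toSite c)]
  exact literal_eq_reduced (μ := ν) (ν := μ) (α := α) (β := β) hLc hr hS hδs hSt hS01 hS10 sf sm j (toSite c)

end Fubini

end Summit.QuantumFields.BalabanUV.Beta.GAN24.ExchangeLatticeWordReduced

end
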